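import Summits.ResolutionOfSingularities.ResolutionOfSingularities.Theorems.FrobeniusLadderFInjectiveMacaulayficationGradedChartClauseRel
import Summits.ResolutionOfSingularities.ResolutionOfSingularities.Theorems.FrobeniusLadderFInjectiveMacaulayficationWeightedConeCore
import HarnessLib

/-!
# (H3-gd-rel) THE RELATIVE GRADED ENGINE `gradedConeFiModelRel` — weighted blow-up along a linear stratum `V(X_J)`
# (crux `FrobeniusLadder.FInjectiveMacaulayfication` stmt-ResolutionOfSingularities-15315, chain w45a; CRUX-PLAN v7 §3
# «(H3-gd-rel) the relative GRADED engine (same J-device on G5/G5ᵍ: weights zero off J)»; lead seat res-L1-w45a-lead-1 gen 3)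

[OURS · L1 W4.5a] AI-written; AI review is weaker than expert review. NOT a statement of any manuscript; no named fact.

THE STATEMENT (G5 `GradedConeFiModel.stub_gradedConeFiModel` p488729 is the case `J = univ`). `k` a field of
characteristic `p`; `J ⊆ Fin n` non-empty; weights `w` with `w_v > 0`, `c_v · w_v = N` for `v ∈ J` and `w_v = 0` OFF `J`;
Veronese saturation of `I_N = (x^b : wt b ≥ N)` (a monomial ideal supported on the LINEAR STRATUM `V(X_J)`, since every
monomial of positive weight involves a `J`-variable); `f` weighted homogeneous of weight `D` with `(f)` prime and all
`x̄_v ≠ 0` in `R = k[X]/(f)`. IF `R` satisfies the clause (Cohen–Macaulay + Frobenius-closed parameter ideals) at every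
maximal ideal missing some `x̄ⱼ`, `j ∈ J` — i.e. at the closed points OFF `V(X_J)` — THEN `Spec R` has a proper birational
model with domain stalks satisfying the crux clause at EVERY point: the weighted blow-up `Bl_{I_N R}`, covered by the charts
`R[I_N R/x̄_v^{c_v}]`, `v ∈ J`.

This is the first ENGINE whose input has a NON-ISOLATED bad locus of graded (not Cartier–Newton) type: e.g. `E₈⁰ × 𝔸¹`
(`f = z² + x³ + y⁵ ∈ k[x,y,z,t]`, `J = {x,y,z}`, weights `(10,6,15,0)`, bad locus = the `t`-axis at `p = 2,3,5`), and more
generally weighted-homogeneous families `f(x_J; t)` equisingular along `V(X_J)`. It is a hole-#3 PRODUCER: the model is an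
isomorphism off `V(I_N R) = V(X_J) ∩ Spec R` (affine blow-up), so it yields STRONG⁺-type steps at the generic point of the
stratum (wrapper: res-L1-w45a-stub-5's line).

THE PROOF = the lead's `WeightedConeCore.weightedConeFiModel_of_chartClause` (p460946, E6‴ glue over `BlowupFiModelOfCover`
+ `ReesCoverOfPowers`) made relative: the cover of `Proj` by the charts `x̄_v^{c_v}`, `v ∈ J` (a generator `x̄^b`, `wt b ≥ N`,
involves some `j ∈ J` because `w = 0` off `J`, and `(x̄^b)^{c_j} = x̄_j^{c_j} · x̄^{b'}` with `x̄^{b'} ∈ I^{c_j-1}` by Veronese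
saturation); OFF the centre the relative Jacobson step `CNConeFiModelRel.exists_maximal_not_mem_X_of_le` (stub-5 p497132);
ON the exceptional locus the relative chart clause `GradedChartClauseRel.gradedChartClauseRel` (lead, p499040).
No definitions, no named facts. [folklore]
-/

set_option linter.dupNamespace false

noncomputable section

open Literature.AlgebraicGeometry.Resolution AlgebraicGeometry MvPolynomial

namespace Summit.ResolutionOfSingularities.ResolutionOfSingularities.Theorems.FInjectiveMacaulayfication.GradedConeFiModelRel

open Summit.ResolutionOfSingularities.ResolutionOfSingularities.Theorems.FInjectiveMacaulayfication
open WeightCoaction WeightedConeCore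

/-- If the weights vanish off `J`, an exponent vector of positive weight involves a `J`-variable. [folklore] -/
theorem exists_mem_ne_zero_of_weight_pos {n : ℕ} (J : Finset (Fin n)) (w : Fin n → ℕ)
    (hw0 : ∀ v : Fin n, v ∉ J → w v = 0) (b : Fin n →₀ ℕ) (hb : 0 < Finsupp.weight w b) :
    ∃ j ∈ J, b j ≠ 0 := by
  by_contra hcon
  push Not at hcon
  have hzero : Finsupp.weight w b = 0 := by
    rw [Finsupp.weight_apply, Finsupp.sum]
    refine Finset.sum_eq_zero fun i _ => ?_
    by_cases hi : i ∈ J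
    · rw [hcon i hi, zero_smul]
    · rw [hw0 i hi, smul_zero]
  omega

/-- With weights vanishing off `J`, the monomial ideal `I_N` (`N > 0`) lies in the ideal `(X_j : j ∈ J)` of the linear
stratum `V(X_J)`. [folklore] -/
theorem weightIdeal_le_span_XJ {k : Type} [Field k] {n : ℕ} (J : Finset (Fin n)) (w : Fin n → ℕ)
    (hw0 : ∀ v : Fin n, v ∉ J → w v = 0) (N : ℕ) (hN : 0 < N) :
    Ideal.span {m : MvPolynomial (Fin n) k | ∃ b : Fin n →₀ ℕ, N ≤ Finsupp.weight w b ∧ m = monomial b 1} ≤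
      Ideal.span ((fun j : Fin n => (X j : MvPolynomial (Fin n) k)) '' (J : Set (Fin n))) := by
  rw [Ideal.span_le]
  rintro _ ⟨b, hb, rfl⟩
  obtain ⟨i, hiJ, hi⟩ := exists_mem_ne_zero_of_weight_pos J w hw0 b (lt_of_lt_of_le hN hb)
  have hdec : b = Finsupp.single i 1 + (b - Finsupp.single i 1) := by
    ext j
    simp only [Finsupp.coe_add, Pi.add_apply, Finsupp.coe_tsub, Pi.sub_apply, Finsupp.single_apply]
    split_ifs with h
    · subst h; omega
    · omega
  rw [hdec, monomial_single_add, pow_one]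
  exact Ideal.mul_mem_right _ _ (Ideal.subset_span (Set.mem_image_of_mem _ (Finset.mem_coe.mpr hiJ)))

/-- **THE RELATIVE GRADED ENGINE (H3-gd-rel)** — see the module docstring. Weighted blow-up of the weighted-homogeneous
prime hypersurface `Spec k[X]/(f)` along the linear stratum `V(X_J)` (weights positive on `J`, zero off `J`, Veronese
saturation of `I_N`): the clause OFF `V(X_J)` implies the crux clause at EVERY point of the model. [folklore] -/
theorem gradedConeFiModelRel (p : ℕ) [Fact p.Prime] (k : Type) [Field k] [CharP k p] (n : ℕ)
    (J : Finset (Fin n)) (hJ : J.Nonempty)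
    (w : Fin n → ℕ) (N : ℕ) (c : Fin n → ℕ) (hN : 0 < N) (hwc : ∀ v ∈ J, 0 < w v ∧ c v * w v = N)
    (hw0 : ∀ v : Fin n, v ∉ J → w v = 0)
    (hpow : ∀ (K : ℕ) (b : Fin n →₀ ℕ), K * N ≤ Finsupp.weight w b →
      (MvPolynomial.monomial b (1 : k) : MvPolynomial (Fin n) k) ∈
        (Ideal.span {m : MvPolynomial (Fin n) k | ∃ b : Fin n →₀ ℕ, N ≤ Finsupp.weight w b ∧
          m = MvPolynomial.monomial b 1}) ^ K)
    (f : MvPolynomial (Fin n) k) (D : ℕ) (hf : MvPolynomial.IsWeightedHomogeneous w f D)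
    (hfprime : (Ideal.span {f}).IsPrime)
    (hXne : ∀ v : Fin n, Ideal.Quotient.mk (Ideal.span {f}) (MvPolynomial.X v) ≠ 0)
    (hoff : ∀ (Q : Ideal (MvPolynomial (Fin n) k ⧸ Ideal.span {f})) [Q.IsMaximal],
      (∃ j ∈ J, Ideal.Quotient.mk (Ideal.span {f}) (MvPolynomial.X j) ∉ Q) →
      ∀ d : ℕ, ringKrullDim (Localization.AtPrime Q) = d → ∀ s : Fin d → Localization.AtPrime Q,
        (Ideal.span (Set.range s)).radical.IsMaximal →
          RingTheory.Sequence.IsWeaklyRegular (Localization.AtPrime Q) (List.ofFn s) ∧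
          ∀ y : Localization.AtPrime Q, (∃ e : ℕ, y ^ p ^ e ∈ Ideal.span
            ((fun z : Localization.AtPrime Q => z ^ p ^ e) ''
              (Ideal.span (Set.range s) : Set (Localization.AtPrime Q)))) → y ∈ Ideal.span (Set.range s)) :
    ∃ (X' : Scheme.{0}) (π : X' ⟶ Spec (.of (MvPolynomial (Fin n) k ⧸ Ideal.span {f}))), IsProper π ∧
      Literature.AlgebraicGeometry.Resolution.IsBirational π ∧
      ∀ y : X', IsDomain (X'.presheaf.stalk y) ∧ ∀ d : ℕ, ringKrullDim (X'.presheaf.stalk y) = d →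
        ∀ s : Fin d → X'.presheaf.stalk y, (Ideal.span (Set.range s)).radical.IsMaximal →
          RingTheory.Sequence.IsWeaklyRegular (X'.presheaf.stalk y) (List.ofFn s) ∧
          ∀ z : X'.presheaf.stalk y, (∃ e : ℕ, z ^ p ^ e ∈
              Ideal.span ((fun w : X'.presheaf.stalk y => w ^ p ^ e) ''
                (Ideal.span (Set.range s) : Set (X'.presheaf.stalk y)))) →
            z ∈ Ideal.span (Set.range s) := by
  classical
  haveI := hfprime
  -- `R = k[X]/(f)` is a Noetherian Jacobson domain of characteristic `p`
  haveI : IsDomain (MvPolynomial (Fin n) k ⧸ Ideal.span {f}) := Ideal.Quotient.isDomain _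
  haveI : CharP (MvPolynomial (Fin n) k ⧸ Ideal.span {f}) p :=
    charP_of_injective_algebraMap (algebraMap k (MvPolynomial (Fin n) k ⧸ Ideal.span {f})).injective p
  obtain ⟨j₀, hj₀⟩ := hJ
  -- chart selector: the charts are the `x̄_v^{c_v}`, `v ∈ J` (indices off `J` repeat the chart of `j₀`)
  obtain ⟨π, hπ⟩ : ∃ π : Fin n → Fin n, π = fun j => if j ∈ J then j else j₀ := ⟨_, rfl⟩
  have hπJ : ∀ j : Fin n, π j ∈ J := fun j => by
    rw [hπ]
    dsimp only
    split_ifs with h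
    · exact h
    · exact hj₀
  have hπid : ∀ j ∈ J, π j = j := fun j hj => by
    rw [hπ]
    dsimp only
    rw [if_pos hj]
  -- names: the centre `I = I_N · R` and the covering family `v j = x̄_{π j} ^ c_{π j}`
  obtain ⟨I, hI⟩ : ∃ I : Ideal (MvPolynomial (Fin n) k ⧸ Ideal.span {f}),
      I = (Ideal.span {m : MvPolynomial (Fin n) k | ∃ b : Fin n →₀ ℕ, N ≤ Finsupp.weight w b ∧
        m = MvPolynomial.monomial b 1}).map (Ideal.Quotient.mk (Ideal.span {f})) := ⟨_, rfl⟩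
  obtain ⟨v, hv⟩ : ∃ v : Fin n → MvPolynomial (Fin n) k ⧸ Ideal.span {f},
      v = fun j => Ideal.Quotient.mk (Ideal.span {f}) (MvPolynomial.X (π j)) ^ c (π j) := ⟨_, rfl⟩
  have hc : ∀ j ∈ J, 0 < c j := fun j hj => Nat.pos_of_ne_zero fun h => by
    have h2 := (hwc j hj).2
    rw [h, zero_mul] at h2
    omega
  -- `X j ^ c j ∈ I_N` for `j ∈ J`
  have hXcI : ∀ j ∈ J, (X j : MvPolynomial (Fin n) k) ^ c j ∈
      Ideal.span {m : MvPolynomial (Fin n) k | ∃ b : Fin n →₀ ℕ, N ≤ Finsupp.weight w b ∧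
        m = MvPolynomial.monomial b 1} := by
    intro j hj
    rw [X_pow_eq_monomial]
    refine monomial_mem_weightIdeal w N _ ?_
    rw [Finsupp.weight_single, smul_eq_mul, (hwc j hj).2]
  -- `v j ∈ I`, `v j ≠ 0`, `I ≠ 0`
  have hvI : ∀ j : Fin n, v j ∈ I := by
    intro j
    rw [hv, hI]
    dsimp only
    rw [← map_pow]
    exact Ideal.mem_map_of_mem _ (hXcI (π j) (hπJ j))
  have hv0 : ∀ j : Fin n, v j ≠ 0 := fun j => by
    rw [hv]
    exact pow_ne_zero _ (hXne (π j))
  have hI0 : I ≠ ⊥ := fun h => hv0 j₀ (by simpa [h] using hvI j₀)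
  -- the centre lies in the ideal of the `J`-variables (weights vanish off `J`)
  have hIle : I ≤ Ideal.span ((fun j : Fin n => Ideal.Quotient.mk (Ideal.span {f}) (MvPolynomial.X j)) '' (J : Set (Fin n))) := by
    rw [hI, show ((fun j : Fin n => Ideal.Quotient.mk (Ideal.span {f}) (MvPolynomial.X j)) '' (J : Set (Fin n))) =
      Ideal.Quotient.mk (Ideal.span {f}) '' ((fun j : Fin n => (X j : MvPolynomial (Fin n) k)) '' (J : Set (Fin n))) from
      by rw [Set.image_image], ← Ideal.map_span]
    exact Ideal.map_mono (weightIdeal_le_span_XJ J w hw0 N hN)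
  -- THE COVER: every generator `x̄^b`, `wt b ≥ N`, involves some `j ∈ J`, and `(x̄^b)^{c_j} = x̄ⱼ^{c_j} · x̄^{b'}`
  have hcov : (HomogeneousIdeal.irrelevant (reesGrading I)).toIdeal ≤
      (Ideal.span (Set.range fun j : Fin n => reesT (I := I) (v j) (hvI j))).radical := by
    refine ReesCoverOfPowers.stub_reesCoverOfPowers _ I
      (Ideal.Quotient.mk (Ideal.span {f}) '' {m : MvPolynomial (Fin n) k | ∃ b : Fin n →₀ ℕ,
        N ≤ Finsupp.weight w b ∧ m = MvPolynomial.monomial b 1}) (by rw [hI, Ideal.map_span]) n v hvI ?_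
    rintro _ ⟨_, ⟨b, hb, rfl⟩, rfl⟩
    -- pick a `J`-variable `j` occurring in `b`
    obtain ⟨j, hjJ, hj⟩ := exists_mem_ne_zero_of_weight_pos J w hw0 b (lt_of_lt_of_le hN hb)
    have hle : Finsupp.single j (c j) ≤ c j • b := Finsupp.single_le_iff.mpr (by
      rw [Finsupp.smul_apply, smul_eq_mul]
      exact Nat.le_mul_of_pos_right _ (Nat.pos_of_ne_zero hj))
    have hsplit : c j • b = Finsupp.single j (c j) + (c j • b - Finsupp.single j (c j)) := by
      rw [add_comm, tsub_add_cancel_of_le hle]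
    have hvj : v j = Ideal.Quotient.mk (Ideal.span {f}) (X j) ^ c j := by
      rw [hv]
      dsimp only
      rw [hπid j hjJ]
    refine ⟨j, c j, hc j hjJ, Ideal.Quotient.mk (Ideal.span {f})
      (MvPolynomial.monomial (c j • b - Finsupp.single j (c j)) 1), ?_, ?_⟩
    · -- `x̄^{b'} ∈ I ^ (c_j - 1)` by the Veronese saturation hypothesis
      rw [hI, ← Ideal.map_pow]
      refine Ideal.mem_map_of_mem _ (hpow (c j - 1) _ ?_)
      have hwt : Finsupp.weight w (c j • b) =
          N + Finsupp.weight w (c j • b - Finsupp.single j (c j)) := by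
        conv_lhs => rw [hsplit]
        rw [map_add, Finsupp.weight_single, smul_eq_mul, (hwc j hjJ).2]
      have hwt' : Finsupp.weight w (c j • b) = c j * Finsupp.weight w b := by
        rw [map_nsmul, smul_eq_mul]
      have h1 : c j * N ≤ c j * Finsupp.weight w b := Nat.mul_le_mul_left _ hb
      have h2 : (c j - 1) * N + N = c j * N := by
        rcases Nat.exists_eq_succ_of_ne_zero (hc j hjJ).ne' with ⟨e, he⟩
        rw [he, Nat.succ_sub_one, Nat.succ_mul]
      omega
    · -- the identity `(x̄^b)^{c_j} = x̄ⱼ^{c_j} · x̄^{b'}`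
      rw [hvj, ← map_pow (Ideal.Quotient.mk (Ideal.span {f})) (X j),
        ← map_pow (Ideal.Quotient.mk (Ideal.span {f})) (MvPolynomial.monomial b (1 : k)), ← map_mul]
      congr 1
      rw [MvPolynomial.monomial_pow, one_pow, X_pow_eq_monomial, MvPolynomial.monomial_mul, one_mul, ← hsplit]
  -- OFF THE CENTRE (relative Jacobson step): a prime `P ⊉ I` generalises a closed point off `V(X_J)`
  have hoff' : ∀ (P : Ideal (MvPolynomial (Fin n) k ⧸ Ideal.span {f})) [P.IsPrime], ¬ I ≤ P →
      IsDomain (Localization.AtPrime P) ∧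
      ∀ d : ℕ, ringKrullDim (Localization.AtPrime P) = d → ∀ s : Fin d → Localization.AtPrime P,
        (Ideal.span (Set.range s)).radical.IsMaximal →
          RingTheory.Sequence.IsWeaklyRegular (Localization.AtPrime P) (List.ofFn s) ∧
          ∀ y : Localization.AtPrime P, (∃ e : ℕ, y ^ p ^ e ∈ Ideal.span
            ((fun z : Localization.AtPrime P => z ^ p ^ e) ''
              (Ideal.span (Set.range s) : Set (Localization.AtPrime P)))) → y ∈ Ideal.span (Set.range s) := by
    intro P _ hP
    obtain ⟨Q, hQ, hPQ, j, hjJ, hj⟩ := CNConeFiModelRel.exists_maximal_not_mem_X_of_le f J I hIle P hP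
    haveI := hQ
    exact ClauseOfMaximal.fiClause_atPrime_of_le p hPQ ⟨inferInstance, hoff Q ⟨j, hjJ, hj⟩⟩
  -- ON THE EXCEPTIONAL LOCUS, chart by chart: the relative graded chart clause (p499040)
  have hon' : ∀ (j : Fin n) (Q : Ideal (blowupAlgebra I (v j))) [Q.IsMaximal],
      algebraMap (MvPolynomial (Fin n) k ⧸ Ideal.span {f}) (blowupAlgebra I (v j)) (v j) ∈ Q →
      ∀ d : ℕ, ringKrullDim (Localization.AtPrime Q) = d → ∀ s : Fin d → Localization.AtPrime Q,
        (Ideal.span (Set.range s)).radical.IsMaximal →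
          RingTheory.Sequence.IsWeaklyRegular (Localization.AtPrime Q) (List.ofFn s) ∧
          ∀ y : Localization.AtPrime Q, (∃ e : ℕ, y ^ p ^ e ∈ Ideal.span
            ((fun z : Localization.AtPrime Q => z ^ p ^ e) ''
              (Ideal.span (Set.range s) : Set (Localization.AtPrime Q)))) → y ∈ Ideal.span (Set.range s) := by
    subst hI hv
    intro j Q _ hQ
    have ha₀ : MvPolynomial.IsWeightedHomogeneous w (MvPolynomial.X (π j) ^ c (π j) : MvPolynomial (Fin n) k) N := by
      have h := (MvPolynomial.isWeightedHomogeneous_X k w (π j)).pow (c (π j))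
      rwa [smul_eq_mul, (hwc (π j) (hπJ j)).2] at h
    have huX : Ideal.Quotient.mk (Ideal.span {f}) (MvPolynomial.X (π j)) ^ c (π j) ∈
        Ideal.span ((fun j : Fin n => Ideal.Quotient.mk (Ideal.span {f}) (MvPolynomial.X j)) '' (J : Set (Fin n))) :=
      Ideal.pow_mem_of_mem _ (Ideal.subset_span (Set.mem_image_of_mem
        (fun j : Fin n => Ideal.Quotient.mk (Ideal.span {f}) (MvPolynomial.X j)) (Finset.mem_coe.mpr (hπJ j)))) _
        (hc (π j) (hπJ j))
    exact GradedChartClauseRel.gradedChartClauseRel p k n J w f D hf hfprime N hN (MvPolynomial.X (π j) ^ c (π j)) ha₀ _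
      (map_pow _ _ _) (hv0 j) huX hpow hoff Q hQ
  exact BlowupFiModelOfCover.stub_blowupFiModelOfCover p (MvPolynomial (Fin n) k ⧸ Ideal.span {f}) I n v
    hvI hI0 hv0 hcov hoff' hon'

end Summit.ResolutionOfSingularities.ResolutionOfSingularities.Theorems.FInjectiveMacaulayfication.GradedConeFiModelRel

end
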